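import Mathlib
import Summits.Ventures.PercRepro2.Defs
import Summits.Ventures.PercRepro2.Graph
import Summits.Ventures.PercRepro2.OneColourSwitch
import Summits.Ventures.PercRepro2.RegionHubSign
import Summits.Ventures.PercRepro2.SideSwitch
import Summits.Ventures.PercRepro2.SideSwitchComps
import Summits.Ventures.PercRepro2.M9NoPocketDefs
import Summits.Ventures.PercRepro2.M9GeneralDHD
import Summits.Ventures.PercRepro2.M9PocketVirtualEdge

/-!
# A virtual `T`-edge — the `K`-only data (blind cell PercRepro2, p3 g42, 2026-08-30;
`proofs/P3-POCKETRK.md` §10⁶ (b): the virtual graphs `G′ + dr`, `G′ + ds`)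

`G⁺` := `G` with one more edge `{d, b}`, `b ∈ {r, s}`, coloured `Y` (`ωp := fun e => e.elim true ω'`).
Then `d ∈ K₂` always (`d_mem_K2_virt`), `d ∈ M₂` iff in `G` (`d_mem_M2_virt`), the `Y`-world of
`{r, s}` is the `Y`-world of the three exits `r, s, d` in `G` (`mem_K2_virt_iff`), the `W`-world is
that of `G` (`mem_M2_virt_iff`), `Sep` is `Sep` of `G` with «`p, q` not `Y`-joined to `d`»
(`sep2_virt_iff`), `DOne` is the outside condition (`DOne_virt_iff`), the `W`-defect is the outside
defect (`WDefect_virt_iff`), `σ_pq` is unchanged at a `Sep` point (`sigma_pq_virt_eq`), and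
`σ_rs` is the join through the new edge minus the `W`-link (`sigma_rs_virt_eq`).  A colouring of
`G⁺` with the new edge `W` is never `K`-only (`not_konly_virt_of_closed`).  Own work; std axioms.
-/

namespace Summit.Ventures.PercRepro2

namespace NoPocket

open Finset Classical OneColourSwitch SideSwitch

variable {V : Type*} {E : Type*} {ends : E → Sym2 V} {p q r s d b : V} {ω' : Config E}

section VirtualKonly

/-- The restriction of the extension along `some` is the base colouring. -/
lemma ext_some (ω' : Config E) :
    (fun e => (fun e : Option E => e.elim true ω') (some e)) = ω' := rfl

/-- The colour flip of the extension is the extension of the flip with the new edge `W`. -/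
lemma compl_ext_none (ω' : Config E) :
    OneColourSwitch.compl (fun e : Option E => e.elim true ω') none = false := rfl

/-- **`W`-connections of `G⁺` are those of `G`** (the new edge is `Y`). -/
lemma conn_compl_virt_iff {x y : V} :
    Conn (fun e : Option E => e.elim s(d, b) ends)
        (OneColourSwitch.compl (fun e : Option E => e.elim true ω')) x y ↔
      Conn ends (OneColourSwitch.compl ω') x y :=
  conn_virt_iff_of_closed (compl_ext_none ω')

/-- **`Y`-connections of `G⁺`**: through `G`, or across the new edge. -/
lemma conn_virt_iff {x y : V} :
    Conn (fun e : Option E => e.elim s(d, b) ends) (fun e : Option E => e.elim true ω') x y ↔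
      Conn ends ω' x y ∨ (Conn ends ω' x d ∧ Conn ends ω' b y) ∨
        (Conn ends ω' x b ∧ Conn ends ω' d y) :=
  conn_virt_iff_of_open rfl

variable (hb : b = r ∨ b = s)

include hb in
/-- **`d ∈ K₂` in `G⁺`**: through the new edge. -/
lemma d_mem_K2_virt :
    d ∈ K2 (fun e : Option E => e.elim s(d, b) ends) r s (fun e : Option E => e.elim true ω') := by
  rw [mem_K2_iff]
  have hbd : Conn (fun e : Option E => e.elim s(d, b) ends) (fun e : Option E => e.elim true ω')
      b d := conn_symm (conn_of_openAdj ⟨none, rfl, rfl⟩)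
  rcases hb with rfl | rfl
  · exact Or.inl hbd
  · exact Or.inr hbd

/-- **`d ∈ M₂` in `G⁺` iff in `G`.** -/
lemma d_mem_M2_virt_iff :
    d ∈ M2 (fun e : Option E => e.elim s(d, b) ends) r s (fun e : Option E => e.elim true ω') ↔
      d ∈ M2 ends r s ω' := by
  rw [M2, ← K2, mem_K2_iff, M2, ← K2, mem_K2_iff, conn_compl_virt_iff, conn_compl_virt_iff]

include hb in
/-- **The `Y`-world of `{r, s}` in `G⁺` is the `Y`-world of the three exits in `G`.** -/
lemma mem_K2_virt_iff {x : V} :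
    x ∈ K2 (fun e : Option E => e.elim s(d, b) ends) r s (fun e : Option E => e.elim true ω') ↔
      (Conn ends ω' r x ∨ Conn ends ω' s x ∨ Conn ends ω' d x) := by
  rw [mem_K2_iff, conn_virt_iff, conn_virt_iff]
  rcases hb with rfl | rfl
  · constructor
    · rintro ((h | ⟨_, h⟩ | ⟨_, h⟩) | (h | ⟨_, h⟩ | ⟨_, h⟩))
      · exact Or.inl h
      · exact Or.inl h
      · exact Or.inr (Or.inr h)
      · exact Or.inr (Or.inl h)
      · exact Or.inl h
      · exact Or.inr (Or.inr h)
    · rintro (h | h | h)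
      · exact Or.inl (Or.inl h)
      · exact Or.inr (Or.inl h)
      · exact Or.inl (Or.inr (Or.inr ⟨conn_refl _ _ _, h⟩))
  · constructor
    · rintro ((h | ⟨_, h⟩ | ⟨_, h⟩) | (h | ⟨_, h⟩ | ⟨_, h⟩))
      · exact Or.inl h
      · exact Or.inr (Or.inl h)
      · exact Or.inr (Or.inr h)
      · exact Or.inr (Or.inl h)
      · exact Or.inr (Or.inl h)
      · exact Or.inr (Or.inr h)
    · rintro (h | h | h)
      · exact Or.inl (Or.inl h)
      · exact Or.inr (Or.inl h)
      · exact Or.inr (Or.inr (Or.inr ⟨conn_refl _ _ _, h⟩))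

/-- **The `W`-world of `{r, s}` in `G⁺` is that of `G`.** -/
lemma mem_M2_virt_iff {x : V} :
    x ∈ M2 (fun e : Option E => e.elim s(d, b) ends) r s (fun e : Option E => e.elim true ω') ↔
      x ∈ M2 ends r s ω' := by
  rw [M2, ← K2, mem_K2_iff, M2, ← K2, mem_K2_iff, conn_compl_virt_iff, conn_compl_virt_iff]

include hb in
/-- **`Sep` in `G⁺`**: `Sep` in `G` together with «`p`, `q` not `Y`-joined to `d`». -/
lemma sep2_virt_iff :
    sep2 (fun e : Option E => e.elim s(d, b) ends) p q r s (fun e : Option E => e.elim true ω') ↔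
      sep2 ends p q r s ω' ∧ ¬ Conn ends ω' p d ∧ ¬ Conn ends ω' q d := by
  have key : ∀ u : V, (¬ Conn (fun e : Option E => e.elim s(d, b) ends)
        (fun e : Option E => e.elim true ω') u r ∧
      ¬ Conn (fun e : Option E => e.elim s(d, b) ends) (fun e : Option E => e.elim true ω') u s) ↔
      (¬ Conn ends ω' u r ∧ ¬ Conn ends ω' u s ∧ ¬ Conn ends ω' u d) := by
    intro u
    rw [conn_virt_iff, conn_virt_iff]
    rcases hb with rfl | rfl
    · constructor
      · rintro ⟨h1, h2⟩
        exact ⟨fun h => h1 (Or.inl h), fun h => h2 (Or.inl h),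
          fun h => h1 (Or.inr (Or.inl ⟨h, conn_refl _ _ _⟩))⟩
      · rintro ⟨h1, h2, h3⟩
        exact ⟨fun h => h.elim h1 (fun h => h.elim (fun h => h3 h.1) (fun h => h1 h.1)),
          fun h => h.elim h2 (fun h => h.elim (fun h => h3 h.1) (fun h => h1 h.1))⟩
    · constructor
      · rintro ⟨h1, h2⟩
        exact ⟨fun h => h1 (Or.inl h), fun h => h2 (Or.inl h),
          fun h => h2 (Or.inr (Or.inl ⟨h, conn_refl _ _ _⟩))⟩
      · rintro ⟨h1, h2, h3⟩
        exact ⟨fun h => h.elim h1 (fun h => h.elim (fun h => h3 h.1) (fun h => h2 h.1)),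
          fun h => h.elim h2 (fun h => h.elim (fun h => h3 h.1) (fun h => h2 h.1))⟩
  unfold sep2 sepY
  constructor
  · rintro ⟨⟨h1, h2, h3, h4⟩, ⟨h5, h6, h7, h8⟩⟩
    obtain ⟨hp1, hp2, hp3⟩ := (key p).1 ⟨h1, h2⟩
    obtain ⟨hq1, hq2, hq3⟩ := (key q).1 ⟨h3, h4⟩
    rw [conn_compl_virt_iff] at h5 h6 h7 h8
    exact ⟨⟨⟨hp1, hp2, hq1, hq2⟩, ⟨h5, h6, h7, h8⟩⟩, hp3, hq3⟩
  · rintro ⟨⟨⟨h1, h2, h3, h4⟩, ⟨h5, h6, h7, h8⟩⟩, hpd, hqd⟩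
    obtain ⟨hp1, hp2⟩ := (key p).2 ⟨h1, h2, hpd⟩
    obtain ⟨hq1, hq2⟩ := (key q).2 ⟨h3, h4, hqd⟩
    refine ⟨⟨hp1, hp2, hq1, hq2⟩, ?_⟩
    simp only [conn_compl_virt_iff]
    exact ⟨h5, h6, h7, h8⟩

include hb in
/-- **`DOne` in `G⁺`**: no vertex other than `r, s, d` in both the `Y`-world of the three exits
and the `W`-world of `{r, s}` of `G`. -/
lemma DOne_virt_iff :
    DOne (fun e : Option E => e.elim s(d, b) ends) r s d (fun e : Option E => e.elim true ω') ↔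
      ∀ x, x ≠ r → x ≠ s → x ≠ d →
        (Conn ends ω' r x ∨ Conn ends ω' s x ∨ Conn ends ω' d x) → x ∉ M2 ends r s ω' := by
  unfold DOne
  constructor
  · intro h x hxr hxs hxd hxK hxM
    exact h x hxr hxs hxd ((mem_K2_virt_iff hb).2 hxK) (mem_M2_virt_iff.2 hxM)
  · intro h x hxr hxs hxd hxK hxM
    exact h x hxr hxs hxd ((mem_K2_virt_iff hb).1 hxK) (mem_M2_virt_iff.1 hxM)

include hb in
/-- **The `W`-defect in `G⁺`** is the outside defect read with the `Y`-world of the three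
exits. -/
lemma WDefect_virt_iff :
    WDefect (fun e : Option E => e.elim s(d, b) ends) p q r s d
        (fun e : Option E => e.elim true ω') ↔
      (Conn ends (OneColourSwitch.compl ω') d p ∨ Conn ends (OneColourSwitch.compl ω') d q ∨
        ∃ x, x ≠ r ∧ x ≠ s ∧ x ≠ d ∧ (Conn ends ω' r x ∨ Conn ends ω' s x ∨ Conn ends ω' d x) ∧
          Conn ends (OneColourSwitch.compl ω') d x) := by
  unfold WDefect
  simp only [conn_compl_virt_iff, mem_K2_virt_iff hb]

include hb in
/-- **`σ_pq` in `G⁺` at a `Sep` point** is that of `G`. -/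
lemma sigma_pq_virt_eq (hsep : sep2 ends p q r s ω') (hpd : ¬ Conn ends ω' p d) :
    sigma (fun e : Option E => e.elim s(d, b) ends) (fun e : Option E => e.elim true ω') p q =
      sigma ends ω' p q := by
  unfold sigma
  rw [if_congr conn_compl_virt_iff rfl rfl]
  congr 1
  apply if_congr _ rfl rfl
  rw [conn_virt_iff]
  constructor
  · rintro (h | ⟨h, _⟩ | ⟨h, _⟩)
    · exact h
    · exact (hpd h).elim
    · exfalso
      rcases hb with rfl | rfl
      · exact hsep.1.1 h
      · exact hsep.1.2.1 h
  · exact fun h => Or.inl h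

/-- **`σ_rs` in `G⁺`**: the join through the new edge minus the `W`-link of `G`. -/
lemma sigma_rs_virt_eq :
    sigma (fun e : Option E => e.elim s(d, b) ends) (fun e : Option E => e.elim true ω') r s =
      (if (Conn ends ω' r s ∨ (Conn ends ω' r d ∧ Conn ends ω' b s) ∨
          (Conn ends ω' r b ∧ Conn ends ω' d s)) then (1 : ℤ) else 0) -
      (if Conn ends (OneColourSwitch.compl ω') r s then (1 : ℤ) else 0) := by
  unfold sigma
  rw [if_congr conn_virt_iff rfl rfl, if_congr conn_compl_virt_iff rfl rfl]

/-- A colouring of `G⁺` with the new edge `W` has `d ∈ M₂`: it is never `K`-only. -/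
lemma d_mem_M2_virt_of_closed (hb : b = r ∨ b = s) {ωp : Config (Option E)}
    (h0 : ωp none = false) :
    d ∈ M2 (fun e : Option E => e.elim s(d, b) ends) r s ωp := by
  rw [M2, ← K2, mem_K2_iff]
  have hbd : Conn (fun e : Option E => e.elim s(d, b) ends) (OneColourSwitch.compl ωp) b d :=
    conn_symm (conn_of_openAdj ⟨none, by simp [OneColourSwitch.compl, h0], rfl⟩)
  rcases hb with rfl | rfl
  · exact Or.inl hbd
  · exact Or.inr hbd

/-- A colouring of `G⁺` with the new edge `Y` is the extension of its restriction. -/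
lemma eq_ext_of_open {ωp : Config (Option E)} (h1 : ωp none = true) :
    ωp = fun e : Option E => e.elim true (fun e => ωp (some e)) := by
  funext e
  rcases e with _ | e
  · exact h1
  · rfl

end VirtualKonly

end NoPocket

end Summit.Ventures.PercRepro2
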